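import Literature.MathematicalPhysics.QuantumChemistry.PositivityConditions
import Literature.MathematicalPhysics.QuantumLattice.HubbardLiebConfig
import HarnessLib

/-!
# Ventures/CertifiedQuantumChemistry — Rows/GMatrixSectorKernel.lean: the `G` matrix of a sector
# state is SINGULAR (an exact kernel vector from `N_β N̂_α − N_α N̂_β`)

HONEST FRAMING (verbatim): certified bounds for a stated model Hamiltonian in a stated basis; not a
claim about the real molecule beyond that model.

Seat rdm-B (gen 14), zero compute; ROWS-1 courtesy file (no row, no claim node, nothing asserted about
any model). It is the Lean form of rdm-A's structural-face observation F1
(`pub-qchem-rdm/FORMAT-qcl1-addendum-17-faces.md`, 2026-08-22): in every `(N_α, N_β) = (a, b)` sector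
instance of the cell's v2RDM programme the particle-hole block `G` has NO positive-definite (Slater)
point, because the operator `N_β N̂_α − N_α N̂_β` annihilates the sector while its coefficient vector
lies in the span of the `G` operator family `{a†_i a_j}` (the diagonal members `a†_{xσ} a_{xσ} = n_{xσ}`).
For the particle-hole RDM `particleHoleRDM ψ = ²G^{ij}_{kl} = ⟨ψ| a†_i a_j a†_l a_k |ψ⟩`
(`Literature/…/PositivityConditions.lean`, Mazziotti 2007 eq. (13)) of ANY vector `ψ` of the sector this
reads, row by row,

  `b · Σ_x ²G^{I}_{(xα, xα)} − a · Σ_x ²G^{I}_{(xβ, xβ)} = ⟨ψ| a†_{I₁} a_{I₂} (b N̂_α − a N̂_β) |ψ⟩ = 0`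

(`particleHoleRDM_sector_kernel`): the vector `z′ = b Σ_x e_{(xα,xα)} − a Σ_x e_{(xβ,xβ)}` is in the
kernel of `²G` (`particleHoleRDM_mulVec_sectorKernel`), a nonzero vector whenever `(a, b) ≠ (0, 0)` and
the orbital set is non-empty. Consequence for solvers (words, not Lean): an interior-point code that
REQUIRES a strictly feasible primal point is ineligible on the un-reduced `G` block of a sector programme;
facial reduction by `z′` (or the sector equalities) removes the face. Everything is PROVED (0 sorry).
-/

noncomputable section

namespace Summit.Ventures.CertifiedQuantumChemistry

open Matrix Finset
open Literature.MathematicalPhysics.QuantumLattice Literature.MathematicalPhysics.QuantumChemistry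

variable {Λ : Type*} [LinearOrder Λ] [Fintype Λ]

/-- `N̂_↑ ψ = a ψ` in the sector `(a, b)`. [folklore] -/
private theorem sum_numberOp_up_mulVec {a b : ℕ} {ψ : Fock (Orb Λ)} (hψ : IsInSector a b ψ) :
    (∑ y : Λ, numberOp y 0) *ᵥ ψ = (a : ℂ) • ψ := by
  funext s
  rw [Matrix.sum_mulVec, Finset.sum_apply, Pi.smul_apply, smul_eq_mul]
  simp only [LiebThm1.numberOp_eq_diagonal, mulVec_diagonal]
  rw [← Finset.sum_mul, Finset.sum_boole]
  by_cases hs : (upPart s).card = a ∧ (downPart s).card = b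
  · rw [← hs.1]; rfl
  · rw [hψ s hs, mul_zero, mul_zero]

/-- `N̂_↓ ψ = b ψ` in the sector `(a, b)`. [folklore] -/
private theorem sum_numberOp_down_mulVec {a b : ℕ} {ψ : Fock (Orb Λ)} (hψ : IsInSector a b ψ) :
    (∑ y : Λ, numberOp y 1) *ᵥ ψ = (b : ℂ) • ψ := by
  funext s
  rw [Matrix.sum_mulVec, Finset.sum_apply, Pi.smul_apply, smul_eq_mul]
  simp only [LiebThm1.numberOp_eq_diagonal, mulVec_diagonal]
  rw [← Finset.sum_mul, Finset.sum_boole]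
  by_cases hs : (upPart s).card = a ∧ (downPart s).card = b
  · rw [← hs.2]; rfl
  · rw [hψ s hs, mul_zero, mul_zero]

/-- A column sum of `²G` over the diagonal spin-`σ` members of the `G` family is the matrix element of
`a†_{I₁} a_{I₂} N̂_σ`: `Σ_x ²G^{I}_{(xσ, xσ)} = ⟨ψ| a†_{I₁} a_{I₂} N̂_σ |ψ⟩`. -/
theorem sum_particleHoleRDM_diag (ψ : Fock (Orb Λ)) (I : Orb Λ × Orb Λ) (σ : Fin 2) :
    ∑ x : Λ, particleHoleRDM ψ I (orb x σ, orb x σ) =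
      star ψ ⬝ᵥ (creation I.1 * annihilation I.2 * ∑ x : Λ, numberOp x σ) *ᵥ ψ := by
  simp only [particleHoleRDM, Finset.mul_sum, Matrix.sum_mulVec, dotProduct_sum, Matrix.mul_assoc]
  rfl

/-- **The sector kernel vector of `²G`** (rdm-A F1, row form): for every vector `ψ` of the
`(N_α, N_β) = (a, b)` sector and every row index `I = (i, j)`,
`b · Σ_x ²G^{I}_{(xα,xα)} − a · Σ_x ²G^{I}_{(xβ,xβ)} = ⟨ψ| a†_i a_j (b N̂_α − a N̂_β) |ψ⟩ = 0`. -/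
theorem particleHoleRDM_sector_kernel {a b : ℕ} {ψ : Fock (Orb Λ)} (hψ : IsInSector a b ψ)
    (I : Orb Λ × Orb Λ) :
    (b : ℂ) * ∑ x : Λ, particleHoleRDM ψ I (orb x 0, orb x 0) -
      (a : ℂ) * ∑ x : Λ, particleHoleRDM ψ I (orb x 1, orb x 1) = 0 := by
  rw [sum_particleHoleRDM_diag, sum_particleHoleRDM_diag]
  simp only [← mulVec_mulVec]
  rw [sum_numberOp_up_mulVec hψ, sum_numberOp_down_mulVec hψ]
  simp only [mulVec_smul, dotProduct_smul, smul_eq_mul]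
  ring

/-- The kernel vector `z′ = b Σ_x e_{(xα,xα)} − a Σ_x e_{(xβ,xβ)}` of rdm-A's F1 as a function on the
column index set of `²G`. -/
theorem particleHoleRDM_mulVec_sectorKernel {a b : ℕ} {ψ : Fock (Orb Λ)} (hψ : IsInSector a b ψ) :
    particleHoleRDM ψ *ᵥ
        (fun J : Orb Λ × Orb Λ =>
          ∑ x : Λ, ((if J = (orb x 0, orb x 0) then (b : ℂ) else 0) -
            (if J = (orb x 1, orb x 1) then (a : ℂ) else 0))) = 0 := by
  funext I
  rw [Pi.zero_apply, mulVec, dotProduct]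
  have h := particleHoleRDM_sector_kernel hψ I
  calc ∑ J, particleHoleRDM ψ I J *
          ∑ x : Λ, ((if J = (orb x 0, orb x 0) then (b : ℂ) else 0) -
            (if J = (orb x 1, orb x 1) then (a : ℂ) else 0))
      = ∑ x : Λ, ∑ J, particleHoleRDM ψ I J *
          ((if J = (orb x 0, orb x 0) then (b : ℂ) else 0) -
            (if J = (orb x 1, orb x 1) then (a : ℂ) else 0)) := by
        simp only [Finset.mul_sum]
        rw [Finset.sum_comm]
    _ = ∑ x : Λ, ((b : ℂ) * particleHoleRDM ψ I (orb x 0, orb x 0) -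
          (a : ℂ) * particleHoleRDM ψ I (orb x 1, orb x 1)) := by
        refine Finset.sum_congr rfl fun x _ => ?_
        simp only [mul_sub, mul_ite, mul_zero, Finset.sum_sub_distrib, Finset.sum_ite_eq', Finset.mem_univ,
          if_true]
        ring
    _ = 0 := by rw [Finset.sum_sub_distrib, ← Finset.mul_sum, ← Finset.mul_sum]; exact h

end Summit.Ventures.CertifiedQuantumChemistry

end
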